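import Literature.NumberTheory.ZetaValues.AperyLikeGeneratingFunctions
import HarnessLib

/-!
# Koecher's Apéry-like formula for `ζ(5)` (proof of the named fact `zeta_five_apery_like`)

Topic `Literature/NumberTheory/ZetaValues`; proofs-only companion of `AperyLikeGeneratingFunctions.lean`,
discharging `Literature.NumberTheory.ZetaValues.zeta_five_apery_like`:
`ζ(5) = 2 Σ_{k≥1} (−1)^{k+1}/(k⁵ C(2k,k)) − (5/2) Σ_{k≥1} ((−1)^{k+1}/(k³ C(2k,k))) Σ_{j<k} j⁻²`
[M. Koecher, Math. Intelligencer 2 (1980) 62–64; Borwein–Bailey–Girgensohn 2004, (3.22); Tauraso 2020, (3)].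

## Proof (Wilf–Zeilberger, after Kh. & T. Hessami Pilehrood)

Kh. Hessami Pilehrood, T. Hessami Pilehrood, *Generating function identities for `ζ(2n+2)`, `ζ(2n+3)` via the
WZ method*, Electron. J. Combin. **15** (2008) #R35 = arXiv:0801.1591, §2, prove Koecher's generating-function
identity (1–2) from the WZ pair `F(n,k) = (−1)ⁿ k! (1+a)_n (1−a)_n / ((2n+k+1)! ((n+k+1)² − a²))`,
`G(n,k) = (−1)ⁿ k! (1+a)_n (1−a)_n (5(n+1)² − a² + k² + 4k(n+1)) / ((2n+k+2)! ((n+k+1)² − a²) (2n+2))` and their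
Proposition 1 (`Σ_k F(0,k) = Σ_n G(n,0)` when the boundary sums vanish). The formula for `ζ(5)` is the coefficient
of `a²`; we run the SAME argument directly on the `a²`-coefficients of the pair, which again form a WZ pair
(now involving the harmonic numbers `H_n = Σ_{m ≤ n} m⁻²`): with `c(n,k) = (−1)ⁿ k! n!²/(2n+k+1)!`,
`D = (n+k+1)²`, `Q = 5(n+1)² + k² + 4k(n+1)`,
`F₁(n,k) = c (1/D² − H_n/D)`, `G₁(n,k) = c/((2n+k+2)(2n+2)) · ((Q − D)/D² − H_n Q/D)`,
one has `F₁(n+1,k) − F₁(n,k) = G₁(n,k+1) − G₁(n,k)` (`koecher_wz`, a rational identity), `F₁(0,k) = (k+1)⁻⁵`,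
`G₁(n,0) = (−1)ⁿ (4/(n+1)² − 5H_n)/(2(n+1)³ C(2n+2,n+1))`, and the boundary terms vanish because
`|c(n,k)| ≤ n!²/(2n+1)! ≤ 1` and `H_n ≤ 2` (`wz_tsum_eq`, the generic summation lemma). No analytic continuation
or coefficient extraction is needed.

All helpers are private theorems (no definitions); the only public declaration is `zeta_five_apery_like_holds`.
-/

open Finset Filter Topology

noncomputable section

namespace Literature.NumberTheory.ZetaValues

/-- **WZ summation** with vanishing boundary terms (the case of [HessamiPilehrood2008WZ, Prop. 1], after
Amdeberhan–Zeilberger, in which both boundary limits are `0`):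
if `F(n+1,k) − F(n,k) = G(n,k+1) − G(n,k)`, each `F(n,·)` is summable, `G(n,k) → 0` (`k → ∞`),
`Σ_k F(n,k) → 0` (`n → ∞`) and `G(·,0)` is summable, then `Σ_k F(0,k) = Σ_n G(n,0)`. [folklore] -/
private theorem wz_tsum_eq {F G : ℕ → ℕ → ℝ} (hWZ : ∀ n k, F (n + 1) k - F n k = G n (k + 1) - G n k)
    (hF : ∀ n, Summable (F n)) (hG : ∀ n, Tendsto (G n) atTop (𝓝 0))
    (hlim : Tendsto (fun n => ∑' k, F n k) atTop (𝓝 0)) (hG0 : Summable fun n => G n 0) :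
    ∑' k, F 0 k = ∑' n, G n 0 := by
  -- `T(n+1) − T(n) = −G(n,0)` for `T(n) = Σ_k F(n,k)`
  have hstep : ∀ n, ∑' k, F (n + 1) k - ∑' k, F n k = -G n 0 := by
    intro n
    have h1 : Tendsto (fun K => ∑ k ∈ range K, (F (n + 1) k - F n k)) atTop
        (𝓝 (∑' k, F (n + 1) k - ∑' k, F n k)) := by
      simp only [sum_sub_distrib]
      exact (hF (n + 1)).hasSum.tendsto_sum_nat.sub (hF n).hasSum.tendsto_sum_nat
    have h2 : Tendsto (fun K => ∑ k ∈ range K, (F (n + 1) k - F n k)) atTop (𝓝 (0 - G n 0)) := by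
      have e : ∀ K, ∑ k ∈ range K, (F (n + 1) k - F n k) = G n K - G n 0 := fun K => by
        rw [sum_congr rfl fun k _ => hWZ n k]; exact sum_range_sub (G n) K
      simp only [e]
      exact (hG n).sub tendsto_const_nhds
    rw [tendsto_nhds_unique h1 h2, zero_sub]
  -- `T(N) − T(0) = −Σ_{n<N} G(n,0)`, then `N → ∞`
  have hsum : ∀ N, ∑' k, F N k - ∑' k, F 0 k = -∑ n ∈ range N, G n 0 := fun N => by
    rw [← sum_range_sub (fun n => ∑' k, F n k) N, sum_congr rfl fun n _ => hstep n, sum_neg_distrib]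
  have h3 : Tendsto (fun N => ∑' k, F N k - ∑' k, F 0 k) atTop (𝓝 (0 - ∑' k, F 0 k)) :=
    hlim.sub tendsto_const_nhds
  simp only [hsum] at h3
  have h4 : Tendsto (fun N => -∑ n ∈ range N, G n 0) atTop (𝓝 (-∑' n, G n 0)) :=
    hG0.hasSum.tendsto_sum_nat.neg
  linarith [tendsto_nhds_unique h3 h4]

/-- The hypergeometric factor under `n ↦ n+1`: `k!(n+1)!²/(2n+k+3)! = (k! n!²/(2n+k+1)!) · (n+1)²/((2n+k+2)(2n+k+3))`.
[folklore] -/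
private theorem hyp_succ_n (n k : ℕ) :
    ((k.factorial : ℝ) * ((n + 1).factorial : ℝ) ^ 2 / ((2 * (n + 1) + k + 1).factorial : ℝ)) =
      (k.factorial : ℝ) * (n.factorial : ℝ) ^ 2 / ((2 * n + k + 1).factorial : ℝ) *
        (((n : ℝ) + 1) ^ 2 / ((2 * (n : ℝ) + k + 2) * (2 * (n : ℝ) + k + 3))) := by
  have e1 : ((2 * (n + 1) + k + 1).factorial : ℝ) = (2 * (n : ℝ) + k + 3) * (2 * (n : ℝ) + k + 2) *
      ((2 * n + k + 1).factorial : ℝ) := by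
    rw [show 2 * (n + 1) + k + 1 = (2 * n + k + 1) + 1 + 1 by ring, Nat.factorial_succ, Nat.factorial_succ]
    push_cast; ring
  have e2 : ((n + 1).factorial : ℝ) = ((n : ℝ) + 1) * (n.factorial : ℝ) := by
    rw [Nat.factorial_succ]; push_cast; ring
  have h1 : ((2 * n + k + 1).factorial : ℝ) ≠ 0 := by positivity
  rw [e1, e2]
  field_simp

/-- The hypergeometric factor under `k ↦ k+1`: `(k+1)! n!²/(2n+k+2)! = (k! n!²/(2n+k+1)!) · (k+1)/(2n+k+2)`.
[folklore] -/
private theorem hyp_succ_k (n k : ℕ) :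
    (((k + 1).factorial : ℝ) * (n.factorial : ℝ) ^ 2 / ((2 * n + (k + 1) + 1).factorial : ℝ)) =
      (k.factorial : ℝ) * (n.factorial : ℝ) ^ 2 / ((2 * n + k + 1).factorial : ℝ) *
        (((k : ℝ) + 1) / (2 * (n : ℝ) + k + 2)) := by
  have e1 : ((2 * n + (k + 1) + 1).factorial : ℝ) = (2 * (n : ℝ) + k + 2) * ((2 * n + k + 1).factorial : ℝ) := by
    rw [show 2 * n + (k + 1) + 1 = (2 * n + k + 1) + 1 by ring, Nat.factorial_succ]
    push_cast; ring
  have e2 : ((k + 1).factorial : ℝ) = ((k : ℝ) + 1) * (k.factorial : ℝ) := by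
    rw [Nat.factorial_succ]; push_cast; ring
  have h1 : ((2 * n + k + 1).factorial : ℝ) ≠ 0 := by positivity
  rw [e1, e2]
  field_simp

/-- **The `a²`-coefficient WZ pair of Koecher's identity**: `F₁(n+1,k) − F₁(n,k) = G₁(n,k+1) − G₁(n,k)`.
[folklore] -/
private theorem koecher_wz (n k : ℕ) :
    let F : ℕ → ℕ → ℝ := fun n k =>
      (-1 : ℝ) ^ n * ((k.factorial : ℝ) * (n.factorial : ℝ) ^ 2 / ((2 * n + k + 1).factorial : ℝ)) *
        (1 / (((n : ℝ) + k + 1) ^ 2) ^ 2 - (∑ m ∈ range n, 1 / ((m : ℝ) + 1) ^ 2) / ((n : ℝ) + k + 1) ^ 2)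
    let G : ℕ → ℕ → ℝ := fun n k =>
      (-1 : ℝ) ^ n * ((k.factorial : ℝ) * (n.factorial : ℝ) ^ 2 / ((2 * n + k + 1).factorial : ℝ)) /
          ((2 * (n : ℝ) + k + 2) * (2 * (n : ℝ) + 2)) *
        ((5 * ((n : ℝ) + 1) ^ 2 + (k : ℝ) ^ 2 + 4 * (k : ℝ) * ((n : ℝ) + 1) - ((n : ℝ) + k + 1) ^ 2) /
            (((n : ℝ) + k + 1) ^ 2) ^ 2 -
          (∑ m ∈ range n, 1 / ((m : ℝ) + 1) ^ 2) *
            (5 * ((n : ℝ) + 1) ^ 2 + (k : ℝ) ^ 2 + 4 * (k : ℝ) * ((n : ℝ) + 1)) / ((n : ℝ) + k + 1) ^ 2)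
    F (n + 1) k - F n k = G n (k + 1) - G n k := by
  intro F G
  simp only [F, G]
  rw [hyp_succ_n, hyp_succ_k, sum_range_succ, pow_succ]
  set c : ℝ := (k.factorial : ℝ) * (n.factorial : ℝ) ^ 2 / ((2 * n + k + 1).factorial : ℝ) with hc
  set s : ℝ := (-1 : ℝ) ^ n with hs
  set h : ℝ := ∑ m ∈ range n, 1 / ((m : ℝ) + 1) ^ 2 with hh
  push_cast
  have h1 : (n : ℝ) + k + 1 ≠ 0 := by positivity
  have h2 : (n : ℝ) + 1 + k + 1 ≠ 0 := by positivity
  have h3 : (n : ℝ) + (k + 1) + 1 ≠ 0 := by positivity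
  have h4 : 2 * (n : ℝ) + k + 2 ≠ 0 := by positivity
  have h5 : 2 * (n : ℝ) + k + 3 ≠ 0 := by positivity
  have h6 : 2 * (n : ℝ) + 2 ≠ 0 := by positivity
  have h7 : (n : ℝ) + 1 ≠ 0 := by positivity
  have h8 : 2 * (n : ℝ) + (k + 1) + 2 ≠ 0 := by positivity
  field_simp
  ring


/-- `H_n = Σ_{m ≤ n} m⁻² ∈ [0, 2]`. [folklore] -/
private theorem harm_bounds (n : ℕ) :
    0 ≤ ∑ m ∈ range n, 1 / ((m : ℝ) + 1) ^ 2 ∧ ∑ m ∈ range n, 1 / ((m : ℝ) + 1) ^ 2 ≤ 2 := by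
  refine ⟨sum_nonneg fun m _ => by positivity, ?_⟩
  have h : ∀ n : ℕ, ∑ m ∈ range (n + 1), 1 / ((m : ℝ) + 1) ^ 2 ≤ 2 - 1 / ((n : ℝ) + 1) := by
    intro n
    induction n with
    | zero => norm_num
    | succ n ih =>
      rw [sum_range_succ]
      push_cast
      have h1 : 1 / (((n : ℝ) + 1 + 1) ^ 2) ≤ 1 / ((n : ℝ) + 1) - 1 / ((n : ℝ) + 1 + 1) := by
        rw [div_sub_div _ _ (by positivity) (by positivity), div_le_div_iff₀ (by positivity) (by positivity)]
        nlinarith [(n.cast_nonneg : (0 : ℝ) ≤ n)]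
      linarith
  calc ∑ m ∈ range n, 1 / ((m : ℝ) + 1) ^ 2 ≤ ∑ m ∈ range (n + 1), 1 / ((m : ℝ) + 1) ^ 2 :=
        sum_le_sum_of_subset_of_nonneg (Finset.range_mono (Nat.le_succ n)) fun m _ _ => by positivity
    _ ≤ 2 := (h n).trans (by linarith [(by positivity : (0 : ℝ) < 1 / ((n : ℝ) + 1))])

/-- The hypergeometric factor is nonnegative and at most `n!²/(2n+1)! ≤ 1/(2n+1)`. [folklore] -/
private theorem hyp_bounds (n k : ℕ) :
    0 ≤ (k.factorial : ℝ) * (n.factorial : ℝ) ^ 2 / ((2 * n + k + 1).factorial : ℝ) ∧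
      (k.factorial : ℝ) * (n.factorial : ℝ) ^ 2 / ((2 * n + k + 1).factorial : ℝ) ≤
        (n.factorial : ℝ) ^ 2 / ((2 * n + 1).factorial : ℝ) ∧
      (n.factorial : ℝ) ^ 2 / ((2 * n + 1).factorial : ℝ) ≤ 1 / (2 * (n : ℝ) + 1) := by
  refine ⟨by positivity, ?_, ?_⟩
  · -- `k! (2n+1)! ≤ (2n+k+1)!`
    have h := Nat.le_of_dvd (Nat.factorial_pos _) (Nat.factorial_mul_factorial_dvd_factorial_add k (2 * n + 1))
    have h' : (k.factorial : ℝ) * ((2 * n + 1).factorial : ℝ) ≤ ((2 * n + k + 1).factorial : ℝ) := by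
      rw [show 2 * n + k + 1 = k + (2 * n + 1) by ring]; exact_mod_cast h
    rw [div_le_div_iff₀ (by positivity) (by positivity)]
    nlinarith [(by positivity : (0 : ℝ) ≤ (n.factorial : ℝ) ^ 2)]
  · -- `n!² ≤ (2n)!` and `(2n+1)! = (2n+1)(2n)!`
    have h := Nat.le_of_dvd (Nat.factorial_pos _) (Nat.factorial_mul_factorial_dvd_factorial_add n n)
    have h' : (n.factorial : ℝ) ^ 2 ≤ ((2 * n).factorial : ℝ) := by
      rw [sq, two_mul]; exact_mod_cast h
    rw [Nat.factorial_succ, div_le_div_iff₀ (by positivity) (by positivity)]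
    push_cast
    nlinarith [(by positivity : (0 : ℝ) ≤ 2 * (n : ℝ) + 1)]

/-- The analytic hypotheses of `wz_tsum_eq` for the pair `(F₁, G₁)`: from `|c(n,k)| ≤ n!²/(2n+1)! ≤ 1`, `H_n ≤ 2`
and `(n+k+1)² ≥ (k+1)²`: `|F₁(n,k)| ≤ 3 n!²/((2n+1)!(k+1)²)` and `|G₁(n,k)| ≤ 14/((2n+k+2)(2n+2))`. [folklore] -/
private theorem koecher_pair_facts :
    let F : ℕ → ℕ → ℝ := fun n k =>
      (-1 : ℝ) ^ n * ((k.factorial : ℝ) * (n.factorial : ℝ) ^ 2 / ((2 * n + k + 1).factorial : ℝ)) *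
        (1 / (((n : ℝ) + k + 1) ^ 2) ^ 2 - (∑ m ∈ range n, 1 / ((m : ℝ) + 1) ^ 2) / ((n : ℝ) + k + 1) ^ 2)
    let G : ℕ → ℕ → ℝ := fun n k =>
      (-1 : ℝ) ^ n * ((k.factorial : ℝ) * (n.factorial : ℝ) ^ 2 / ((2 * n + k + 1).factorial : ℝ)) /
          ((2 * (n : ℝ) + k + 2) * (2 * (n : ℝ) + 2)) *
        ((5 * ((n : ℝ) + 1) ^ 2 + (k : ℝ) ^ 2 + 4 * (k : ℝ) * ((n : ℝ) + 1) - ((n : ℝ) + k + 1) ^ 2) /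
            (((n : ℝ) + k + 1) ^ 2) ^ 2 -
          (∑ m ∈ range n, 1 / ((m : ℝ) + 1) ^ 2) *
            (5 * ((n : ℝ) + 1) ^ 2 + (k : ℝ) ^ 2 + 4 * (k : ℝ) * ((n : ℝ) + 1)) / ((n : ℝ) + k + 1) ^ 2)
    (∀ n, Summable (F n)) ∧ (∀ n, Tendsto (G n) atTop (𝓝 0)) ∧
      Tendsto (fun n => ∑' k, F n k) atTop (𝓝 0) ∧ Summable (fun n => G n 0) := by
  intro F G
  have hS2 : Summable fun k : ℕ => 1 / ((k : ℝ) + 1) ^ 2 := by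
    simpa using (summable_nat_add_iff 1).2 (Real.summable_one_div_nat_pow.2 one_lt_two)
  -- the bound on `F`
  have hFb : ∀ n k : ℕ, ‖F n k‖ ≤
      3 * ((n.factorial : ℝ) ^ 2 / ((2 * n + 1).factorial : ℝ)) * (1 / ((k : ℝ) + 1) ^ 2) := by
    intro n k
    obtain ⟨hc0, hcb, -⟩ := hyp_bounds n k
    obtain ⟨hH0, hH2⟩ := harm_bounds n
    rw [Real.norm_eq_abs]
    simp only [F]
    set c := (k.factorial : ℝ) * (n.factorial : ℝ) ^ 2 / ((2 * n + k + 1).factorial : ℝ)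
    set h := ∑ m ∈ range n, 1 / ((m : ℝ) + 1) ^ 2
    set D := ((n : ℝ) + k + 1) ^ 2 with hD
    have hn : (0 : ℝ) ≤ n := n.cast_nonneg
    have hk : (0 : ℝ) ≤ k := k.cast_nonneg
    have hD1 : 1 ≤ D := by rw [hD]; nlinarith
    have hDk : ((k : ℝ) + 1) ^ 2 ≤ D := by rw [hD]; nlinarith
    have hDpos : 0 < D := by positivity
    rw [abs_mul, abs_mul, abs_pow, abs_neg, abs_one, one_pow, one_mul, abs_of_nonneg hc0]
    have h1 : |1 / D ^ 2 - h / D| ≤ 3 / D := by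
      have e1 : 1 / D ^ 2 ≤ 1 / D := div_le_div_of_nonneg_left zero_le_one hDpos (by nlinarith)
      have e2 : h / D ≤ 2 / D := by gcongr
      have e3 : 0 ≤ 1 / D ^ 2 := by positivity
      have e4 : 0 ≤ h / D := by positivity
      have e5 : (1 : ℝ) / D + 2 / D = 3 / D := by ring
      rw [abs_le]; constructor <;> linarith
    have h2 : 3 / D ≤ 3 * (1 / ((k : ℝ) + 1) ^ 2) := by
      rw [mul_one_div]; exact div_le_div_of_nonneg_left (by norm_num) (by positivity) hDk
    calc c * |1 / D ^ 2 - h / D| ≤ c * (3 / D) := by gcongr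
      _ ≤ ((n.factorial : ℝ) ^ 2 / ((2 * n + 1).factorial : ℝ)) * (3 * (1 / ((k : ℝ) + 1) ^ 2)) := by gcongr
      _ = _ := by ring
  -- the bound on `G`
  have hGb : ∀ n k : ℕ, ‖G n k‖ ≤ 14 / ((2 * (n : ℝ) + k + 2) * (2 * (n : ℝ) + 2)) := by
    intro n k
    obtain ⟨hc0, hcb, hb1⟩ := hyp_bounds n k
    obtain ⟨hH0, hH2⟩ := harm_bounds n
    rw [Real.norm_eq_abs]
    simp only [G]
    set c := (k.factorial : ℝ) * (n.factorial : ℝ) ^ 2 / ((2 * n + k + 1).factorial : ℝ)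
    set h := ∑ m ∈ range n, 1 / ((m : ℝ) + 1) ^ 2
    set D := ((n : ℝ) + k + 1) ^ 2 with hD
    set Q := 5 * ((n : ℝ) + 1) ^ 2 + (k : ℝ) ^ 2 + 4 * (k : ℝ) * ((n : ℝ) + 1) with hQ
    set E := (2 * (n : ℝ) + k + 2) * (2 * (n : ℝ) + 2) with hE
    have hn : (0 : ℝ) ≤ n := n.cast_nonneg
    have hk : (0 : ℝ) ≤ k := k.cast_nonneg
    have hEpos : 0 < E := by positivity
    have hD1 : 1 ≤ D := by rw [hD]; nlinarith
    have hDpos : 0 < D := by positivity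
    have hQD : D ≤ Q := by rw [hD, hQ]; nlinarith
    have hQ5 : Q ≤ 5 * D := by rw [hD, hQ]; nlinarith
    have hc1 : c ≤ 1 := hcb.trans (hb1.trans (by rw [div_le_one (by positivity)]; linarith))
    rw [abs_mul, abs_div, abs_mul, abs_pow, abs_neg, abs_one, one_pow, one_mul, abs_of_nonneg hc0,
      abs_of_pos hEpos]
    have hbr : |(Q - D) / D ^ 2 - h * Q / D| ≤ 14 := by
      have e1 : 0 ≤ (Q - D) / D ^ 2 := div_nonneg (sub_nonneg.2 hQD) (by positivity)
      have e2 : (Q - D) / D ^ 2 ≤ 4 := by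
        rw [div_le_iff₀ (by positivity)]; nlinarith
      have e3 : 0 ≤ h * Q / D := div_nonneg (mul_nonneg hH0 (by linarith)) hDpos.le
      have e4 : h * Q / D ≤ 10 := by
        rw [div_le_iff₀ hDpos]
        nlinarith [mul_le_mul_of_nonneg_left hQ5 hH0, mul_le_mul_of_nonneg_right hH2 (by positivity : (0 : ℝ) ≤ 5 * D)]
      rw [abs_le]; constructor <;> linarith
    calc c / E * |(Q - D) / D ^ 2 - h * Q / D| ≤ 1 / E * 14 := by gcongr
      _ = 14 / E := by ring
  refine ⟨fun n => ?_, fun n => ?_, ?_, ?_⟩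
  · -- `F(n,·)` summable
    exact Summable.of_norm_bounded ((hS2.mul_left _)) (hFb n)
  · -- `G(n,k) → 0`
    refine squeeze_zero_norm (hGb n) ?_
    refine tendsto_const_nhds.div_atTop ?_
    exact Tendsto.atTop_mul_const (by positivity)
      (tendsto_atTop_add_const_right _ _ (tendsto_atTop_add_const_left _ _ tendsto_natCast_atTop_atTop))
  · -- `Σ_k F(n,k) → 0`
    have hle : ∀ n : ℕ, ‖∑' k, F n k‖ ≤
        3 * ((n.factorial : ℝ) ^ 2 / ((2 * n + 1).factorial : ℝ)) * ∑' k : ℕ, 1 / ((k : ℝ) + 1) ^ 2 :=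
      fun n => tsum_of_norm_bounded (hS2.hasSum.mul_left _) (hFb n)
    refine squeeze_zero_norm hle ?_
    have hb : ∀ n : ℕ, 3 * ((n.factorial : ℝ) ^ 2 / ((2 * n + 1).factorial : ℝ)) * ∑' k : ℕ, 1 / ((k : ℝ) + 1) ^ 2 ≤
        3 * (1 / (2 * (n : ℝ) + 1)) * ∑' k : ℕ, 1 / ((k : ℝ) + 1) ^ 2 := fun n => by
      have := (hyp_bounds n 0).2.2
      have hS0 : 0 ≤ ∑' k : ℕ, 1 / ((k : ℝ) + 1) ^ 2 := tsum_nonneg fun k => by positivity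
      gcongr
    have h0 : ∀ n : ℕ, 0 ≤ 3 * ((n.factorial : ℝ) ^ 2 / ((2 * n + 1).factorial : ℝ)) * ∑' k : ℕ, 1 / ((k : ℝ) + 1) ^ 2 :=
      fun n => mul_nonneg (by positivity) (tsum_nonneg fun k => by positivity)
    refine squeeze_zero h0 hb ?_
    have hlim : Tendsto (fun n : ℕ => 3 * (1 / (2 * (n : ℝ) + 1)) * ∑' k : ℕ, 1 / ((k : ℝ) + 1) ^ 2) atTop
        (𝓝 (3 * 0 * ∑' k : ℕ, 1 / ((k : ℝ) + 1) ^ 2)) :=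
      ((tendsto_const_nhds.div_atTop (tendsto_atTop_add_const_right _ _
        (tendsto_natCast_atTop_atTop.const_mul_atTop two_pos))).const_mul 3).mul_const _
    simpa using hlim
  · -- `G(·,0)` summable
    refine Summable.of_norm_bounded (hS2.mul_left 14) fun n => (hGb n 0).trans ?_
    have hn : (0 : ℝ) ≤ n := n.cast_nonneg
    rw [Nat.cast_zero, add_zero, mul_one_div]
    exact div_le_div_of_nonneg_left (by norm_num) (by positivity) (by nlinarith)


/-- `C(2n+2, n+1) = (2n+2)(2n+1)!/((n+1)² n!²)` in `ℝ`. [folklore] -/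
private theorem centralBinom_succ_eq (n : ℕ) :
    (((n + 1).centralBinom : ℕ) : ℝ) =
      (2 * (n : ℝ) + 2) * ((2 * n + 1).factorial : ℝ) / (((n : ℝ) + 1) ^ 2 * (n.factorial : ℝ) ^ 2) := by
  have h := Nat.choose_mul_factorial_mul_factorial (show n + 1 ≤ 2 * (n + 1) by omega)
  rw [show 2 * (n + 1) - (n + 1) = n + 1 by omega, ← Nat.centralBinom_eq_two_mul_choose,
    show 2 * (n + 1) = (2 * n + 1) + 1 by ring, Nat.factorial_succ (2 * n + 1), Nat.factorial_succ n] at h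
  have h' : (((n + 1).centralBinom : ℕ) : ℝ) * (((n : ℝ) + 1) * (n.factorial : ℝ)) * (((n : ℝ) + 1) * (n.factorial : ℝ)) =
      (2 * (n : ℝ) + 1 + 1) * ((2 * n + 1).factorial : ℝ) := by exact_mod_cast h
  rw [eq_div_iff (by positivity)]
  linear_combination h'

/-- **Koecher's formula for `ζ(5)`** (discharge of the named fact `zeta_five_apery_like`):
`ζ(5) = 2 Σ_{k≥1} (−1)^{k+1}/(k⁵ C(2k,k)) − (5/2) Σ_{k≥1} ((−1)^{k+1}/(k³ C(2k,k))) Σ_{j<k} j⁻²`, by the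
`a²`-coefficient of the Hessami Pilehrood WZ pair for Koecher's identity.
[cite: Koecher1980, (formula for ζ(5))] [cite: BorweinBaileyGirgensohn2004, §3.2.2 (3.22) p. 97] [cite: Tauraso2020, (3)]
[cite: HessamiPilehrood2008WZ, §2 (the WZ pair) and Prop. 1] -/
theorem zeta_five_apery_like_holds : zeta_five_apery_like := by
  obtain ⟨hFs, hGt, hFt, hG0⟩ := koecher_pair_facts
  have key := wz_tsum_eq (fun n k => koecher_wz n k) hFs hGt hFt hG0
  have hS2 : Summable fun k : ℕ => 1 / ((k : ℝ) + 1) ^ 2 := by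
    simpa using (summable_nat_add_iff 1).2 (Real.summable_one_div_nat_pow.2 one_lt_two)
  have hS5 : Summable fun n : ℕ => 1 / (n : ℝ) ^ 5 := Real.summable_one_div_nat_pow.2 (by norm_num)
  unfold zeta_five_apery_like
  rw [Literature.NumberTheory.Transcendental.zetaValue, hS5.tsum_eq_zero_add]
  convert key using 1
  · -- the left-hand side: `F₁(0,k) = (k+1)⁻⁵`
    rw [Nat.cast_zero, zero_pow (by norm_num), div_zero, zero_add]
    refine tsum_congr fun k => ?_
    rw [show 2 * 0 + k + 1 = k + 1 by ring, Nat.factorial_succ]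
    have hk : (k.factorial : ℝ) ≠ 0 := by positivity
    simp only [sum_range_zero, zero_div, sub_zero, pow_zero, one_mul, Nat.factorial_zero, one_pow,
      mul_one, Nat.cast_zero, zero_add, Nat.cast_mul, Nat.cast_succ]
    field_simp
  · -- the right-hand side: `G₁(n,0) = 2·(−1)ⁿ/((n+1)⁵C) − (5/2)·(−1)ⁿ H_n/((n+1)³C)`
    have hC1 : ∀ n : ℕ, (1 : ℝ) ≤ (((n + 1).centralBinom : ℕ) : ℝ) := fun n => by
      exact_mod_cast Nat.succ_le_of_lt (Nat.centralBinom_pos (n + 1))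
    have hA0 : Summable fun k : ℕ => (-1 : ℝ) ^ (k + 2) / (((k + 1 : ℕ) : ℝ) ^ 5 * ((k + 1).centralBinom : ℝ)) := by
      refine Summable.of_norm_bounded hS2 fun k => ?_
      have hpos : (0 : ℝ) < (((k + 1 : ℕ) : ℝ)) ^ 5 * (((k + 1).centralBinom : ℕ) : ℝ) :=
        mul_pos (by positivity) (one_pos.trans_le (hC1 k))
      rw [norm_div, norm_pow, norm_neg, norm_one, one_pow, Real.norm_of_nonneg hpos.le]
      push_cast
      apply div_le_div_of_nonneg_left zero_le_one (by positivity)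
      have hk : (1 : ℝ) ≤ (k : ℝ) + 1 := by linarith [(k.cast_nonneg : (0 : ℝ) ≤ k)]
      calc ((k : ℝ) + 1) ^ 2 ≤ ((k : ℝ) + 1) ^ 5 := pow_le_pow_right₀ hk (by norm_num)
        _ ≤ ((k : ℝ) + 1) ^ 5 * (((k + 1).centralBinom : ℕ) : ℝ) := le_mul_of_one_le_right (by positivity) (hC1 k)
    have hB0 : Summable fun k : ℕ => (-1 : ℝ) ^ (k + 2) / (((k + 1 : ℕ) : ℝ) ^ 3 * ((k + 1).centralBinom : ℝ)) *
        ∑ j ∈ Ico 1 (k + 1), 1 / (j : ℝ) ^ 2 := by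
      refine Summable.of_norm_bounded (hS2.mul_left 2) fun k => ?_
      obtain ⟨-, hH2⟩ := harm_bounds k
      have hHk : 0 ≤ ∑ j ∈ Ico 1 (k + 1), 1 / (j : ℝ) ^ 2 := sum_nonneg fun j _ => by positivity
      have hHk2 : ∑ j ∈ Ico 1 (k + 1), 1 / (j : ℝ) ^ 2 ≤ 2 := by
        rw [Finset.sum_Ico_eq_sum_range, Nat.add_sub_cancel]
        exact le_trans (le_of_eq (sum_congr rfl fun m _ => by push_cast; ring)) hH2
      have hpos : (0 : ℝ) < (((k + 1 : ℕ) : ℝ)) ^ 3 * (((k + 1).centralBinom : ℕ) : ℝ) :=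
        mul_pos (by positivity) (one_pos.trans_le (hC1 k))
      rw [norm_mul, norm_div, norm_pow, norm_neg, norm_one, one_pow, Real.norm_of_nonneg hpos.le,
        Real.norm_of_nonneg hHk]
      push_cast
      have hk : (1 : ℝ) ≤ (k : ℝ) + 1 := by linarith [(k.cast_nonneg : (0 : ℝ) ≤ k)]
      have hden : ((k : ℝ) + 1) ^ 2 ≤ ((k : ℝ) + 1) ^ 3 * (((k + 1).centralBinom : ℕ) : ℝ) :=
        (pow_le_pow_right₀ hk (by norm_num)).trans (le_mul_of_one_le_right (by positivity) (hC1 k))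
      calc 1 / (((k : ℝ) + 1) ^ 3 * (((k + 1).centralBinom : ℕ) : ℝ)) * ∑ j ∈ Ico 1 (k + 1), 1 / (j : ℝ) ^ 2
          ≤ 1 / ((k : ℝ) + 1) ^ 2 * 2 :=
            mul_le_mul (div_le_div_of_nonneg_left zero_le_one (by positivity) hden) hHk2 hHk (by positivity)
        _ = 2 * (1 / ((k : ℝ) + 1) ^ 2) := by ring
    rw [← tsum_mul_left, ← tsum_mul_left, ← (hA0.mul_left 2).tsum_sub (hB0.mul_left (5 / 2))]
    refine tsum_congr fun n => ?_
    have es : ((-1 : ℝ)) ^ (n + 2) = (-1) ^ n := by rw [pow_add]; norm_num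
    have eH : ∑ j ∈ Ico 1 (n + 1), 1 / (j : ℝ) ^ 2 = ∑ m ∈ range n, 1 / ((m : ℝ) + 1) ^ 2 := by
      rw [Finset.sum_Ico_eq_sum_range, Nat.add_sub_cancel]
      exact sum_congr rfl fun m _ => by push_cast; ring
    rw [es, eH, centralBinom_succ_eq n]
    simp only [add_zero, Nat.cast_zero, Nat.factorial_zero, Nat.cast_one, one_mul, mul_zero, zero_mul,
      zero_pow two_ne_zero]
    set h := ∑ m ∈ range n, 1 / ((m : ℝ) + 1) ^ 2
    set s := ((-1 : ℝ)) ^ n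
    push_cast
    have h1 : (n.factorial : ℝ) ≠ 0 := by positivity
    have h2 : ((2 * n + 1).factorial : ℝ) ≠ 0 := by positivity
    have h3 : (n : ℝ) + 1 ≠ 0 := by positivity
    have h4 : 2 * (n : ℝ) + 2 ≠ 0 := by positivity
    field_simp
    ring

end Literature.NumberTheory.ZetaValues
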